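import Literature.Probability.LatticeModels.GridDomainHittingProbability
import Literature.Probability.LatticeModels.KilledWalkLaplacian
import Literature.Probability.LatticeModels.LatticeHarnackConformal
import Literature.Probability.LatticeModels.LatticeDobrushinDomain
import Literature.Analysis.Complex.KoebeInteriorChains
import HarnessLib

/-!
# Groundwork for Lawler–Schramm–Werner's hitting-probability estimate (Prop. 2.2): darts of grid
# domains, boundary values of the Riemann map, harmonicity of the exit-probability ratio

Topic `Literature/Probability/LatticeModels`; companion (proofs only, no definitions, no named facts)
of `GridDomainHittingProbability.lean`, which STATES G. F. Lawler, O. Schramm, W. Werner, *Conformal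
invariance of planar loop-erased random walks and uniform spanning trees*, Ann. Probab. 32 (2004),
Prop. 2.2 (`hittingProbability_ratio_poissonKernel`) and Lemma 5.4 (`boundaryHitting`) as named
facts in the vocabulary `LSWGrid.IsGridDomain / IsClassD / latticeVertices / IsDiscMap / exitProb`.
The printed proof of Prop. 2.2 (§5.2 of the paper) begins "We consider the discrete harmonic
function `h(w) := H(w,u)/H(0,u)`" and uses throughout that a boundary pair `u = (v, [q,v])` is
reached along the half-open edge `[q, v) ⊂ D`, at whose end `ψ_D` has a boundary value ON THE UNIT
CIRCLE. This file proves these three standing facts for the tree's rendering of the statement —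
the part of the argument that concerns only the vocabulary of the statement file:

* **Darts of grid domains** (§2.2: "`v ∈ ℤ² ∩ ∂D`, and `e` is an edge incident with `v` that
  intersects `D`"): for a grid domain `D`, `q ∈ V(D)` and a lattice neighbour `v ∉ V(D)`, the
  half-open edge `[q, v)` lies in `D` (`LSWGrid.mem_of_mem_Ico`), `v ∈ ∂D`
  (`LSWGrid.toComplex_mem_frontier`), and the closed edge between two points of `V(D)` lies in `D`
  (`LSWGrid.segment_subset`). The lattice geometry behind it: an open grid edge meets a closed grid
  edge only if they are the same edge (`LSWGrid.toComplex_mem_hEdge/_vEdge`,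
  `LSWGrid.segment_toComplex_of_adj`).
* **Boundary values lie on the circle** (§2.2: "`ψ(w)` will be shorthand for the limit of `ψ(z)` as
  `z → v` along `e` (which always exists)"; only `|ψ(u)| = 1` is needed to read `λ(w,u;D)` as the
  Poisson kernel): if `ψ` is a conformal map of the open set `D` onto `𝔻` and `ψ ∘ γ → c` along a
  path in `D` tending to a point outside `D`, then `|c| = 1` (`LSWGrid.norm_eq_one_of_tendsto`,
  `LSWGrid.norm_boundaryValue_eq_one`); the inverse map is holomorphic on `𝔻` by the tree's
  `Complex.differentiableOn_invFunOn_image` and `SCV.deriv_ne_zero_of_injOn`.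
* **`h` is a nonnegative killed-harmonic function** (§5.2, first line of the proof; Lawler 1991
  §1.5 / Kozdron–Lawler 2005 §2.3 for `G_A(·, y)` harmonic off the pole): the hypothesis
  `H(0,u) ≠ 0` of Prop. 2.2 makes the series of the killed Green function converge at EVERY start
  (`SRW.summable_killedTrans_of_killedGreen_ne_zero`: comparison along a walk,
  `SRW.killedTrans_walk_le`, and `SRW.reachable_of_killedTrans_ne_zero`), so that `G(·, q)` is
  harmonic for the edge-killed walk off `q` and superharmonic at `q`
  (`SRW.isKilledHarmonicOn_killedGreen`, `SRW.killedGreen_self`, in the vocabulary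
  `IsKilledHarmonicOn / killedAvg` of `KilledWalkLaplacian.lean`), vanishes at isolated vertices
  (`SRW.killedGreen_eq_zero_of_forall_not_adj`), and the ratio
  `w ↦ exitProb D w q v / exitProb D 0 q v = G(w,q)/G(0,q)` is killed-harmonic on `{w ≠ q}` for the
  walk on `V(D)`, equal to `1` at `0`, nonnegative, and `0` off `V(D) ∪ {q}`
  (`LSWGrid.exitProb_ratio_eq`, `LSWGrid.isKilledHarmonicOn_exitProb_ratio`, …).

* **Conformal Harnack and gradient bounds in the statement's vocabulary** (Lemma 5.2 of the
  paper, cases `k = 0, 1`, = the tree's `harnack_conformal` / `lipschitz_conformal` for the conformal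
  map `F = ψ⁻¹` of `𝔻` onto `D`): for `D ∈ 𝔇`, a disc map `ψ`, and `h ≥ 0` lattice-harmonic on
  `V(D)`, at a lattice point `x ∈ V(D)` with `|ψ(x)| ≤ r` one has `h(x) ≍ h(0)` and
  `|h(x + e_k) - h(x)| ≲ h(0)/inrad(D)` with explicit constants depending on `r`
  (`LSWGrid.harnack_isDiscMap`, `LSWGrid.lipschitz_isDiscMap`, `LSWGrid.lipschitz_isDiscMap_near`).

Deliberately NOT here: the estimate itself (Koebe chains beyond the above, the continuous harmonic
approximation Lemma 5.3 and the boundary-hitting Lemma 5.4 of the paper).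

## References

* G. F. Lawler, O. Schramm, W. Werner, Ann. Probab. 32 (2004) 939–995, arXiv:math/0112234, §2.2
  and §5.2 (proof of Prop. 2.2) [LawlerSchrammWerner2004].
* M. J. Kozdron, G. F. Lawler, Electron. J. Probab. 10 (2005) 1442–1467, §2.3 [KozdronLawler2005].
-/

noncomputable section

open Set Metric Filter
open scoped Topology Classical

namespace Literature.Probability.LatticeModels

/-! ## Killed walks: summability from one nonzero value of the Green function, harmonicity -/

namespace SRW

variable {d : ℕ}

/-- **A nonzero killed transition probability certifies a `Gr`-walk**: if
`P[first n steps Gr-edges, position n = q] ≠ 0` for the walk from `p`, then `q` is `Gr`-reachable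
from `p`. [folklore] -/
theorem reachable_of_killedTrans_ne_zero [NeZero d] {Gr : SimpleGraph (Site d)} {n : ℕ}
    {p q : Site d} (h : killedTrans Gr n p q ≠ 0) : Gr.Reachable p q := by
  induction n generalizing p with
  | zero =>
      rw [killedTrans_zero] at h
      by_cases hpq : p = q
      · exact hpq ▸ SimpleGraph.Reachable.refl _
      · exact absurd (if_neg hpq) h
  | succ n ih =>
      rw [killedTrans_succ] at h
      obtain ⟨e, -, he⟩ := Finset.exists_ne_zero_of_sum_ne_zero (right_ne_zero_of_mul h)
      by_cases hadj : Gr.Adj p (p + stepVec e)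
      · rw [if_pos hadj] at he
        exact hadj.reachable.trans (ih he)
      · exact absurd (if_neg hadj) he

/-- **Comparison along a walk**: if `w` is a `Gr`-walk from `x` to `y` (`Gr` a subgraph of the
nearest-neighbour graph), then following `w` and then making an `n`-step transit from `y` to `q`
is one way of making a `(|w| + n)`-step transit from `x` to `q`:
`(2d)^{-|w|} p_n(y,q) ≤ p_{|w|+n}(x,q)`. [folklore] -/
theorem killedTrans_walk_le [NeZero d] {Gr : SimpleGraph (Site d)} (hGr : Gr ≤ zdGraph d)
    {x y : Site d} (w : Gr.Walk x y) (n : ℕ) (q : Site d) :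
    ((2 * d : ℝ)⁻¹) ^ w.length * killedTrans Gr n y q ≤ killedTrans Gr (w.length + n) x q := by
  induction w with
  | nil => simp
  | @cons u v z hadj w' ih =>
      obtain ⟨e₀, he₀⟩ := exists_dir_of_adj (hGr hadj)
      rw [SimpleGraph.Walk.length_cons, show w'.length + 1 + n = (w'.length + n) + 1 by ring,
        killedTrans_succ, pow_succ]
      have hd : (0 : ℝ) ≤ (2 * d : ℝ)⁻¹ := by positivity
      calc (2 * d : ℝ)⁻¹ ^ w'.length * (2 * d : ℝ)⁻¹ * killedTrans Gr n z q
          = (2 * d : ℝ)⁻¹ * ((2 * d : ℝ)⁻¹ ^ w'.length * killedTrans Gr n z q) := by ring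
        _ ≤ (2 * d : ℝ)⁻¹ * killedTrans Gr (w'.length + n) v q :=
            mul_le_mul_of_nonneg_left ih hd
        _ ≤ (2 * d : ℝ)⁻¹ * ∑ e : Dir d, (if Gr.Adj u (u + stepVec e)
              then killedTrans Gr (w'.length + n) (u + stepVec e) q else 0) := by
            refine mul_le_mul_of_nonneg_left ?_ hd
            refine le_trans ?_ (Finset.single_le_sum (f := fun e : Dir d =>
              if Gr.Adj u (u + stepVec e) then killedTrans Gr (w'.length + n) (u + stepVec e) q else 0)
              (fun e _ => ?_) (Finset.mem_univ e₀))
            · rw [← he₀, if_pos hadj]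
            · split_ifs
              · exact killedTrans_nonneg _ _ _ _
              · exact le_rfl

/-- **Summability propagates along `Gr`-walks**: if the series `Σ_n p_n(x,q)` of the killed Green
function converges at the start `x`, it converges at every start `y` that is `Gr`-reachable from
`x` (by `killedTrans_walk_le`, the terms at `y` are dominated by a shifted multiple of the terms
at `x`). [folklore] -/
theorem summable_killedTrans_of_reachable [NeZero d] {Gr : SimpleGraph (Site d)}
    (hGr : Gr ≤ zdGraph d) {x y q : Site d} (hx : Summable fun n => killedTrans Gr n x q)
    (hxy : Gr.Reachable x y) : Summable fun n => killedTrans Gr n y q := by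
  obtain ⟨w⟩ := hxy
  have hdpos : (0 : ℝ) < (2 * d : ℝ)⁻¹ := by
    have : (0 : ℝ) < d := Nat.cast_pos.2 (Nat.pos_of_ne_zero (NeZero.ne d))
    positivity
  have hc : (0 : ℝ) < ((2 * d : ℝ)⁻¹) ^ w.length := pow_pos hdpos _
  have hshift : Summable fun n => killedTrans Gr (w.length + n) x q := by
    have h := (summable_nat_add_iff w.length).2 hx
    simpa only [add_comm] using h
  refine (hshift.mul_left (((2 * d : ℝ)⁻¹) ^ w.length)⁻¹).of_nonneg_of_le
    (fun n => killedTrans_nonneg _ _ _ _) fun n => ?_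
  rw [le_inv_mul_iff₀ hc]
  exact killedTrans_walk_le hGr w n q

/-- **One nonzero value of the killed Green function makes the whole column summable**: if
`G(p₀, q) ≠ 0` (so the series at `p₀` converges — a divergent series has `tsum = 0` — and `q` is
reachable from `p₀`), then `Σ_n p_n(x, q)` converges for EVERY start `x`: starts reachable from
`p₀` by comparison, the others because all their terms vanish. This is how the hypothesis
`H(0,u) ≠ 0` of Lawler–Schramm–Werner's Prop. 2.2 is used on unbounded grid domains. [folklore] -/
theorem summable_killedTrans_of_killedGreen_ne_zero [NeZero d] {Gr : SimpleGraph (Site d)}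
    (hGr : Gr ≤ zdGraph d) {p₀ q : Site d} (h : killedGreen Gr p₀ q ≠ 0) (x : Site d) :
    Summable fun n => killedTrans Gr n x q := by
  have hs : Summable fun n => killedTrans Gr n p₀ q := by
    by_contra hns
    exact h (tsum_eq_zero_of_not_summable hns)
  by_cases hx : Gr.Reachable p₀ x
  · exact summable_killedTrans_of_reachable hGr hs hx
  · have hzero : ∀ n, killedTrans Gr n x q = 0 := by
      intro n
      by_contra hn
      have hxq := reachable_of_killedTrans_ne_zero hn
      obtain ⟨m, hm⟩ : ∃ m, killedTrans Gr m p₀ q ≠ 0 := by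
        by_contra hall
        push Not at hall
        exact h (by simp only [killedGreen, hall, tsum_zero])
      exact hx ((reachable_of_killedTrans_ne_zero hm).trans hxq.symm)
    simp only [hzero]
    exact summable_zero

/-- The killed Green function vanishes at a vertex without `Gr`-edges (other than the pole):
every step from it kills the walk. [folklore] -/
theorem killedGreen_eq_zero_of_forall_not_adj [NeZero d] {Gr : SimpleGraph (Site d)} {p q : Site d}
    (hp : ∀ y, ¬ Gr.Adj p y) (hpq : p ≠ q) : killedGreen Gr p q = 0 := by
  have hzero : ∀ n, killedTrans Gr n p q = 0 := by
    intro n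
    cases n with
    | zero => rw [killedTrans_zero, if_neg hpq]
    | succ n =>
        rw [killedTrans_succ]
        simp only [hp, if_false, Finset.sum_const_zero, mul_zero]
  simp only [killedGreen, hzero, tsum_zero]

/-- **`G(·, q)` is harmonic for the edge-killed walk off the pole** (the first-step equation
`killedGreen_first_step` read in the vocabulary of `KilledWalkLaplacian.lean`), whenever the
defining series converge. [folklore] -/
theorem isKilledHarmonicOn_killedGreen {Gr : SimpleGraph (Site 2)} {q : Site 2}
    (hsum : ∀ x, Summable fun n => killedTrans Gr n x q) :
    IsKilledHarmonicOn Gr (fun p => killedGreen Gr p q) {p | p ≠ q} := by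
  intro p hp
  change killedGreen Gr p q = killedAvg Gr (fun x => killedGreen Gr x q) p
  rw [killedGreen_first_step Gr p q hsum, if_neg hp, zero_add, killedAvg]
  norm_num

/-- **At the pole**: `G(q, q) = 1 + killedAvg G(·, q) (q)` (the visit at time `0` plus the
first-step average), whenever the defining series converge. [folklore] -/
theorem killedGreen_self {Gr : SimpleGraph (Site 2)} {q : Site 2}
    (hsum : ∀ x, Summable fun n => killedTrans Gr n x q) :
    killedGreen Gr q q = 1 + killedAvg Gr (fun p => killedGreen Gr p q) q := by
  rw [killedGreen_first_step Gr q q hsum, if_pos rfl, killedAvg]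
  norm_num

/-- **`G(·, q)` is superharmonic for the edge-killed walk everywhere** (harmonic off `q`, excess
`1` at `q`), whenever the defining series converge. [folklore] -/
theorem isKilledSuperharmonicOn_killedGreen {Gr : SimpleGraph (Site 2)} {q : Site 2}
    (hsum : ∀ x, Summable fun n => killedTrans Gr n x q) (S : Set (Site 2)) :
    IsKilledSuperharmonicOn Gr (fun p => killedGreen Gr p q) S := by
  intro p _
  change killedAvg Gr (fun x => killedGreen Gr x q) p ≤ killedGreen Gr p q
  by_cases hp : p = q
  · rw [hp, killedGreen_self hsum]
    linarith
  · exact ((isKilledHarmonicOn_killedGreen hsum) p hp).ge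

end SRW

/-! ## Grid domains: darts, boundary values, the exit-probability ratio -/

namespace LSWGrid

open Complex
open Literature.Probability.RandomPlanarGeometry (ChordalLERW.siteGraph ChordalLERW.siteGraph_adj_iff
  ChordalLERW.siteGraph_le_zdGraph)

/-! ### Lattice geometry of grid edges -/

/-- Nearest neighbours of `ℤ²` in the complex plane: `y = x ± 1` or `y = x ± i`. [folklore] -/
theorem toComplex_eq_of_adj {x y : Site 2} (h : (zdGraph 2).Adj x y) :
    Site.toComplex y = Site.toComplex x + 1 ∨ Site.toComplex y = Site.toComplex x - 1 ∨
      Site.toComplex y = Site.toComplex x + I ∨ Site.toComplex y = Site.toComplex x - I := by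
  rw [zdGraph_adj_iff] at h
  obtain ⟨i, h | h⟩ := h
  · fin_cases i
    · left
      apply Complex.ext <;> simp [h]
    · right; right; left
      apply Complex.ext <;> simp [h]
  · fin_cases i
    · right; left
      apply Complex.ext <;> simp [h]
    · right; right; right
      apply Complex.ext <;> simp [h]

/-- The closed horizontal unit segment from `Q` to `Q + 1`, in coordinates. [folklore] -/
theorem segment_self_add_one (Q : ℂ) :
    segment ℝ Q (Q + 1) = {P : ℂ | P.im = Q.im ∧ Q.re ≤ P.re ∧ P.re ≤ Q.re + 1} := by
  ext P
  rw [segment_eq_image']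
  constructor
  · rintro ⟨θ, ⟨h0, h1⟩, rfl⟩
    refine ⟨?_, ?_, ?_⟩ <;> simp [h0, h1]
  · rintro ⟨him, h1, h2⟩
    refine ⟨P.re - Q.re, ⟨by linarith, by linarith⟩, ?_⟩
    apply Complex.ext
    · simp
    · simp [him]

/-- The closed vertical unit segment from `Q` to `Q + i`, in coordinates. [folklore] -/
theorem segment_self_add_I (Q : ℂ) :
    segment ℝ Q (Q + I) = {P : ℂ | P.re = Q.re ∧ Q.im ≤ P.im ∧ P.im ≤ Q.im + 1} := by
  ext P
  rw [segment_eq_image']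
  constructor
  · rintro ⟨θ, ⟨h0, h1⟩, rfl⟩
    refine ⟨?_, ?_, ?_⟩ <;> simp [h0, h1]
  · rintro ⟨hre, h1, h2⟩
    refine ⟨P.im - Q.im, ⟨by linarith, by linarith⟩, ?_⟩
    apply Complex.ext
    · simp [hre]
    · simp

/-- **A closed grid edge in coordinates**: the segment between lattice neighbours `a ∼ b` is a
horizontal unit segment `{im = c, k ≤ re ≤ k + 1}` or a vertical one `{re = c, k ≤ im ≤ k + 1}`
with integers `k, c`. [folklore] -/
theorem segment_toComplex_of_adj {a b : Site 2} (h : (zdGraph 2).Adj a b) :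
    (∃ k c : ℤ, segment ℝ (Site.toComplex a) (Site.toComplex b) =
        {P : ℂ | P.im = c ∧ (k : ℝ) ≤ P.re ∧ P.re ≤ k + 1}) ∨
    (∃ k c : ℤ, segment ℝ (Site.toComplex a) (Site.toComplex b) =
        {P : ℂ | P.re = c ∧ (k : ℝ) ≤ P.im ∧ P.im ≤ k + 1}) := by
  rcases toComplex_eq_of_adj h with hb | hb | hb | hb
  · left
    refine ⟨a 0, a 1, ?_⟩
    rw [hb, segment_self_add_one]
    simp
  · left
    refine ⟨a 0 - 1, a 1, ?_⟩
    rw [hb, segment_symm, show Site.toComplex a = Site.toComplex a - 1 + 1 by ring]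
    rw [add_sub_cancel_right, segment_self_add_one]
    ext P
    simp only [mem_setOf_eq, sub_im, one_im, sub_zero, Site.toComplex_im, sub_re, one_re,
      Site.toComplex_re, sub_add_cancel, Int.cast_sub, Int.cast_one]
  · right
    refine ⟨a 1, a 0, ?_⟩
    rw [hb, segment_self_add_I]
    simp
  · right
    refine ⟨a 1 - 1, a 0, ?_⟩
    rw [hb, segment_symm, show Site.toComplex a = Site.toComplex a - I + I by ring]
    rw [add_sub_cancel_right, segment_self_add_I]
    ext P
    simp only [mem_setOf_eq, sub_re, I_re, sub_zero, Site.toComplex_re, sub_im, I_im,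
      Site.toComplex_im, sub_add_cancel, Int.cast_sub, Int.cast_one]

/-- There is no integer strictly between `0` and `1` (real-cast form). [folklore] -/
private theorem no_int_between {m : ℤ} {t : ℝ} (ht0 : 0 < t) (ht1 : t < 1) (h : (m : ℝ) = t) :
    False := by
  have h0 : (0 : ℝ) < m := h ▸ ht0
  have h1 : (m : ℝ) < 1 := h ▸ ht1
  have h0' : 0 < m := by exact_mod_cast h0
  have h1' : m < 1 := by exact_mod_cast h1
  omega

/-- Coordinate increments of lattice neighbours: `(v₀ - q₀, v₁ - q₁) ∈ {(±1, 0), (0, ±1)}`.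
[folklore] -/
theorem sub_apply_of_adj {q v : Site 2} (h : (zdGraph 2).Adj q v) :
    (v 0 - q 0 = 1 ∧ v 1 - q 1 = 0) ∨ (v 0 - q 0 = -1 ∧ v 1 - q 1 = 0) ∨
      (v 0 - q 0 = 0 ∧ v 1 - q 1 = 1) ∨ (v 0 - q 0 = 0 ∧ v 1 - q 1 = -1) := by
  rw [zdGraph_adj_iff] at h
  obtain ⟨i, h | h⟩ := h
  · fin_cases i
    · left; simp [h]
    · right; right; left; simp [h]
  · fin_cases i
    · right; left; simp [h]
    · right; right; right; simp [h]

/-- The abscissa of the moving point `q + t (v - q)` of an edge. [folklore] -/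
theorem edgePoint_re (q v : Site 2) (t : ℝ) :
    (Site.toComplex q + (t : ℂ) * (Site.toComplex v - Site.toComplex q)).re =
      q 0 + t * ((v 0 : ℝ) - q 0) := by
  simp [mul_re]

/-- The ordinate of the moving point `q + t (v - q)` of an edge. [folklore] -/
theorem edgePoint_im (q v : Site 2) (t : ℝ) :
    (Site.toComplex q + (t : ℂ) * (Site.toComplex v - Site.toComplex q)).im =
      q 1 + t * ((v 1 : ℝ) - q 1) := by
  simp [mul_im]

/-- **An open grid edge meets a closed horizontal grid edge only inside it**: if an interior point
`q + t (v - q)`, `0 < t < 1`, of the edge from the lattice point `q` to a neighbour `v` lies on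
the horizontal unit segment `{im = c, k ≤ re ≤ k + 1}` (`k, c ∈ ℤ`), then so does `q` itself.
[folklore] -/
theorem toComplex_mem_hEdge {q v : Site 2} (hqv : (zdGraph 2).Adj q v) {t : ℝ} (ht0 : 0 < t)
    (ht1 : t < 1) {k c : ℤ}
    (hP : Site.toComplex q + (t : ℂ) * (Site.toComplex v - Site.toComplex q) ∈
      {P : ℂ | P.im = c ∧ (k : ℝ) ≤ P.re ∧ P.re ≤ k + 1}) :
    Site.toComplex q ∈ {P : ℂ | P.im = c ∧ (k : ℝ) ≤ P.re ∧ P.re ≤ k + 1} := by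
  obtain ⟨him, h1, h2⟩ := hP
  rw [edgePoint_im] at him
  rw [edgePoint_re] at h1 h2
  simp only [mem_setOf_eq, Site.toComplex_re, Site.toComplex_im]
  rcases sub_apply_of_adj hqv with ⟨ha, hb⟩ | ⟨ha, hb⟩ | ⟨ha, hb⟩ | ⟨ha, hb⟩
  · -- `v = q + 1`: `k ≤ q₀ + t ≤ k + 1` forces `k = q₀`
    have ha' : (v 0 : ℝ) - q 0 = 1 := by exact_mod_cast ha
    have hb' : (v 1 : ℝ) - q 1 = 0 := by exact_mod_cast hb
    rw [ha'] at h1 h2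
    rw [hb'] at him
    have hk1 : (k : ℝ) < q 0 + 1 := by linarith
    have hk2 : ((q 0 : ℤ) : ℝ) < k + 1 := by linarith
    have hk1' : k < q 0 + 1 := by exact_mod_cast hk1
    have hk2' : q 0 < k + 1 := by exact_mod_cast hk2
    refine ⟨by linarith, ?_, ?_⟩
    · exact_mod_cast (show k ≤ q 0 by omega)
    · exact_mod_cast (show q 0 ≤ k + 1 by omega)
  · -- `v = q - 1`: `k ≤ q₀ - t ≤ k + 1` forces `k = q₀ - 1`
    have ha' : (v 0 : ℝ) - q 0 = -1 := by exact_mod_cast ha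
    have hb' : (v 1 : ℝ) - q 1 = 0 := by exact_mod_cast hb
    rw [ha'] at h1 h2
    rw [hb'] at him
    have hk1 : (k : ℝ) < q 0 := by linarith
    have hk2 : ((q 0 : ℤ) : ℝ) - 1 < k + 1 := by linarith
    have hk1' : k < q 0 := by exact_mod_cast hk1
    have hk2' : q 0 - 1 < k + 1 := by exact_mod_cast hk2
    refine ⟨by linarith, ?_, ?_⟩
    · exact_mod_cast (show k ≤ q 0 by omega)
    · exact_mod_cast (show q 0 ≤ k + 1 by omega)
  · -- `v = q + i`: the ordinate `q₁ + t` would be the integer `c`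
    have hb' : (v 1 : ℝ) - q 1 = 1 := by exact_mod_cast hb
    rw [hb'] at him
    exact (no_int_between ht0 ht1 (m := c - q 1) (by push_cast; linarith)).elim
  · -- `v = q - i`: the ordinate `q₁ - t` would be the integer `c`
    have hb' : (v 1 : ℝ) - q 1 = -1 := by exact_mod_cast hb
    rw [hb'] at him
    exact (no_int_between ht0 ht1 (m := q 1 - c) (by push_cast; linarith)).elim

/-- **An open grid edge meets a closed vertical grid edge only inside it**: the vertical
counterpart of `toComplex_mem_hEdge`. [folklore] -/
theorem toComplex_mem_vEdge {q v : Site 2} (hqv : (zdGraph 2).Adj q v) {t : ℝ} (ht0 : 0 < t)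
    (ht1 : t < 1) {k c : ℤ}
    (hP : Site.toComplex q + (t : ℂ) * (Site.toComplex v - Site.toComplex q) ∈
      {P : ℂ | P.re = c ∧ (k : ℝ) ≤ P.im ∧ P.im ≤ k + 1}) :
    Site.toComplex q ∈ {P : ℂ | P.re = c ∧ (k : ℝ) ≤ P.im ∧ P.im ≤ k + 1} := by
  obtain ⟨hre, h1, h2⟩ := hP
  rw [edgePoint_re] at hre
  rw [edgePoint_im] at h1 h2
  simp only [mem_setOf_eq, Site.toComplex_re, Site.toComplex_im]
  rcases sub_apply_of_adj hqv with ⟨ha, hb⟩ | ⟨ha, hb⟩ | ⟨ha, hb⟩ | ⟨ha, hb⟩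
  · -- `v = q + 1`: the abscissa `q₀ + t` would be the integer `c`
    have ha' : (v 0 : ℝ) - q 0 = 1 := by exact_mod_cast ha
    rw [ha'] at hre
    exact (no_int_between ht0 ht1 (m := c - q 0) (by push_cast; linarith)).elim
  · -- `v = q - 1`
    have ha' : (v 0 : ℝ) - q 0 = -1 := by exact_mod_cast ha
    rw [ha'] at hre
    exact (no_int_between ht0 ht1 (m := q 0 - c) (by push_cast; linarith)).elim
  · -- `v = q + i`: `k ≤ q₁ + t ≤ k + 1` forces `k = q₁`
    have ha' : (v 0 : ℝ) - q 0 = 0 := by exact_mod_cast ha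
    have hb' : (v 1 : ℝ) - q 1 = 1 := by exact_mod_cast hb
    rw [ha'] at hre
    rw [hb'] at h1 h2
    have hk1 : (k : ℝ) < q 1 + 1 := by linarith
    have hk2 : ((q 1 : ℤ) : ℝ) < k + 1 := by linarith
    have hk1' : k < q 1 + 1 := by exact_mod_cast hk1
    have hk2' : q 1 < k + 1 := by exact_mod_cast hk2
    refine ⟨by linarith, ?_, ?_⟩
    · exact_mod_cast (show k ≤ q 1 by omega)
    · exact_mod_cast (show q 1 ≤ k + 1 by omega)
  · -- `v = q - i`: `k ≤ q₁ - t ≤ k + 1` forces `k = q₁ - 1`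
    have ha' : (v 0 : ℝ) - q 0 = 0 := by exact_mod_cast ha
    have hb' : (v 1 : ℝ) - q 1 = -1 := by exact_mod_cast hb
    rw [ha'] at hre
    rw [hb'] at h1 h2
    have hk1 : (k : ℝ) < q 1 := by linarith
    have hk2 : ((q 1 : ℤ) : ℝ) - 1 < k + 1 := by linarith
    have hk1' : k < q 1 := by exact_mod_cast hk1
    have hk2' : q 1 - 1 < k + 1 := by exact_mod_cast hk2
    refine ⟨by linarith, ?_, ?_⟩
    · exact_mod_cast (show k ≤ q 1 by omega)
    · exact_mod_cast (show q 1 ≤ k + 1 by omega)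

/-! ### Darts of a grid domain -/

/-- A preconnected set of the plane that meets an open set `D` and its complement meets `∂D`
(`D` and `(closure D)ᶜ` are disjoint open sets). [folklore] -/
theorem inter_frontier_nonempty_of_isPreconnected {D c : Set ℂ} (hD : IsOpen D)
    (hc : IsPreconnected c) (h1 : (c ∩ D).Nonempty) (h2 : (c ∩ Dᶜ).Nonempty) :
    (c ∩ frontier D).Nonempty := by
  by_contra h
  rw [not_nonempty_iff_eq_empty] at h
  have hsub : c ⊆ D ∪ (closure D)ᶜ := by
    intro z hz
    by_cases hz1 : z ∈ closure D
    · rw [closure_eq_self_union_frontier] at hz1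
      rcases hz1 with h' | h'
      · exact Or.inl h'
      · have : z ∈ c ∩ frontier D := ⟨hz, h'⟩
        rw [h] at this
        exact this.elim
    · exact Or.inr hz1
  have hdisj : Disjoint D (closure D)ᶜ :=
    disjoint_left.2 fun z hz hz' => hz' (subset_closure hz)
  rcases hc.subset_or_subset hD isClosed_closure.isOpen_compl hdisj hsub with h' | h'
  · obtain ⟨z, hz, hz'⟩ := h2
    exact hz' (h' hz)
  · obtain ⟨z, hz, hz'⟩ := h1
    exact (h' hz) (subset_closure hz')

/-- A lattice point of a grid domain is not on its boundary (the domain is open). [folklore] -/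
theorem toComplex_notMem_frontier {D : Set ℂ} (hD : IsGridDomain D) {q : Site 2}
    (hq : q ∈ latticeVertices D) : Site.toComplex q ∉ frontier D := by
  rw [hD.1.frontier_eq]
  exact fun h => h.2 hq

/-- **Points of the half-open edge `[q, v)` issued from a lattice point `q` of a grid domain are
not on its boundary**: the boundary is a union of closed grid edges, and by
`toComplex_mem_hEdge/_vEdge` a closed grid edge containing an interior point of `[q, v]` would
contain `q`. [cite: LawlerSchrammWerner2004, §2.2] -/
theorem notMem_frontier_of_mem_Ico {D : Set ℂ} (hD : IsGridDomain D) {q v : Site 2}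
    (hq : q ∈ latticeVertices D) (hqv : (zdGraph 2).Adj q v) {t : ℝ} (ht0 : 0 ≤ t) (ht1 : t < 1) :
    Site.toComplex q + (t : ℂ) * (Site.toComplex v - Site.toComplex q) ∉ frontier D := by
  have hqfr := toComplex_notMem_frontier hD hq
  obtain ⟨-, -, E, hE, hfr⟩ := hD
  intro hmem
  rcases ht0.eq_or_lt with rfl | ht0'
  · simp only [ofReal_zero, zero_mul, add_zero] at hmem
    exact hqfr hmem
  have hmem' := hmem
  rw [hfr, mem_iUnion₂] at hmem'
  obtain ⟨e, heE, hPe⟩ := hmem'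
  have hqe : Site.toComplex q ∈ segment ℝ (Site.toComplex e.1) (Site.toComplex e.2) := by
    rcases segment_toComplex_of_adj (hE e heE) with ⟨k, c, hseg⟩ | ⟨k, c, hseg⟩
    · rw [hseg] at hPe ⊢
      exact toComplex_mem_hEdge hqv ht0' ht1 hPe
    · rw [hseg] at hPe ⊢
      exact toComplex_mem_vEdge hqv ht0' ht1 hPe
  exact hqfr (hfr ▸ mem_iUnion₂.2 ⟨e, heE, hqe⟩)

/-- **The half-open edge `[q, v)` from a lattice point of a grid domain to any lattice neighbour
lies in the domain** ("`e` is an edge incident with `v` that intersects `D`", §2.2): its initial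
point is in `D` and it never meets `∂D`. [cite: LawlerSchrammWerner2004, §2.2] -/
theorem mem_of_mem_Ico {D : Set ℂ} (hD : IsGridDomain D) {q v : Site 2}
    (hq : q ∈ latticeVertices D) (hqv : (zdGraph 2).Adj q v) {t : ℝ} (ht0 : 0 ≤ t) (ht1 : t < 1) :
    Site.toComplex q + (t : ℂ) * (Site.toComplex v - Site.toComplex q) ∈ D := by
  by_contra hnot
  set γ : ℝ → ℂ := fun s => Site.toComplex q + (s : ℂ) * (Site.toComplex v - Site.toComplex q)
    with hγ
  have hcont : Continuous γ := by rw [hγ]; fun_prop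
  have hconn : IsPreconnected (γ '' Icc 0 t) := isPreconnected_Icc.image γ hcont.continuousOn
  have h0 : γ 0 ∈ D := by
    simp only [hγ, ofReal_zero, zero_mul, add_zero]
    exact hq
  obtain ⟨P, ⟨s, hs, rfl⟩, hPfr⟩ := inter_frontier_nonempty_of_isPreconnected hD.1 hconn
    ⟨γ 0, ⟨0, ⟨le_rfl, ht0⟩, rfl⟩, h0⟩ ⟨γ t, ⟨t, ⟨ht0, le_rfl⟩, rfl⟩, hnot⟩
  exact notMem_frontier_of_mem_Ico hD hq hqv hs.1 (lt_of_le_of_lt hs.2 ht1) hPfr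

/-- Along the edge from `q ∈ V(D)` towards a neighbour `v`, the moving point is eventually (as the
parameter tends to `1` from below) — indeed always on `[0,1)` — inside `D`. [folklore] -/
theorem eventually_mem_nhdsLT {D : Set ℂ} (hD : IsGridDomain D) {q v : Site 2}
    (hq : q ∈ latticeVertices D) (hqv : (zdGraph 2).Adj q v) :
    ∀ᶠ t : ℝ in 𝓝[<] (1 : ℝ),
      Site.toComplex q + (t : ℂ) * (Site.toComplex v - Site.toComplex q) ∈ D := by
  filter_upwards [Ico_mem_nhdsLT zero_lt_one] with t ht using mem_of_mem_Ico hD hq hqv ht.1 ht.2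

/-- The moving point of the edge `[q, v]` tends to `v` as the parameter tends to `1` from below.
[folklore] -/
theorem tendsto_edge_nhdsLT (q v : Site 2) :
    Tendsto (fun t : ℝ => Site.toComplex q + (t : ℂ) * (Site.toComplex v - Site.toComplex q))
      (𝓝[<] (1 : ℝ)) (𝓝 (Site.toComplex v)) := by
  have hcont : Continuous fun t : ℝ =>
      Site.toComplex q + (t : ℂ) * (Site.toComplex v - Site.toComplex q) := by fun_prop
  have h := (hcont.tendsto 1).mono_left (nhdsWithin_le_nhds (s := Iio (1 : ℝ)))
  simpa using h

/-- **The far end of a dart is a boundary vertex** (§2.2: "`v ∈ ℤ² ∩ ∂D`"): if `q ∈ V(D)` and the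
lattice neighbour `v` is not in `V(D)`, then `v ∈ ∂D` — it is a limit of points of `[q, v) ⊂ D`
and not in the open set `D`. [cite: LawlerSchrammWerner2004, §2.2] -/
theorem toComplex_mem_frontier {D : Set ℂ} (hD : IsGridDomain D) {q v : Site 2}
    (hq : q ∈ latticeVertices D) (hv : v ∉ latticeVertices D) (hqv : (zdGraph 2).Adj q v) :
    Site.toComplex v ∈ frontier D := by
  rw [hD.1.frontier_eq]
  exact ⟨mem_closure_of_tendsto (tendsto_edge_nhdsLT q v) (eventually_mem_nhdsLT hD hq hqv), hv⟩

/-- **The closed edge between two lattice points of a grid domain lies in the domain** (so the walk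
on `V(D)` along lattice edges is the walk in `D`). [cite: LawlerSchrammWerner2004, §2.2] -/
theorem segment_subset {D : Set ℂ} (hD : IsGridDomain D) {q v : Site 2}
    (hq : q ∈ latticeVertices D) (hv : v ∈ latticeVertices D) (hqv : (zdGraph 2).Adj q v) :
    segment ℝ (Site.toComplex q) (Site.toComplex v) ⊆ D := by
  rw [segment_eq_image']
  rintro _ ⟨t, ⟨ht0, ht1⟩, rfl⟩
  rcases ht1.lt_or_eq with hlt | rfl
  · have h := mem_of_mem_Ico hD hq hqv ht0 hlt
    change Site.toComplex q + t • (Site.toComplex v - Site.toComplex q) ∈ D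
    rwa [Complex.real_smul]
  · have h1 : Site.toComplex q + (1 : ℝ) • (Site.toComplex v - Site.toComplex q) = Site.toComplex v := by
      rw [one_smul, add_sub_cancel]
    change Site.toComplex q + (1 : ℝ) • (Site.toComplex v - Site.toComplex q) ∈ D
    rw [h1]
    exact hv

/-! ### Boundary values of the disc map lie on the circle -/

/-- **Boundary values of a conformal map onto the disc lie on the unit circle.** Let `ψ` map the
open set `D` holomorphically and bijectively onto `𝔻` (`IsDiscMap`), let `γ` be eventually in `D`
along a filter `l` and tend to a point `p ∉ D`, and let `ψ ∘ γ → c`. Then `|c| = 1`: `|c| ≤ 1`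
trivially, and if `c` were inside the disc the holomorphic inverse `ψ⁻¹` (holomorphic on `𝔻` by
`Complex.differentiableOn_invFunOn_image`) would give `γ = ψ⁻¹ ∘ ψ ∘ γ → ψ⁻¹ c ∈ D`, whereas
`γ → p ∉ D`. [cite: LawlerSchrammWerner2004, §2.2] -/
theorem norm_eq_one_of_tendsto {D : Set ℂ} (hD : IsOpen D) {ψ : ℂ → ℂ} (hψ : IsDiscMap D ψ)
    {l : Filter ℝ} [l.NeBot] {γ : ℝ → ℂ} (hγD : ∀ᶠ t in l, γ t ∈ D) {p : ℂ} (hp : p ∉ D)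
    (hγ : Tendsto γ l (𝓝 p)) {c : ℂ} (hc : Tendsto (fun t => ψ (γ t)) l (𝓝 c)) : ‖c‖ = 1 := by
  obtain ⟨hdiff, hbij, -⟩ := hψ
  have hball : ∀ᶠ t in l, ψ (γ t) ∈ ball (0 : ℂ) 1 := hγD.mono fun t ht => hbij.mapsTo ht
  have hle : ‖c‖ ≤ 1 := by
    have hmem : c ∈ closure (ball (0 : ℂ) 1) := mem_closure_of_tendsto hc hball
    rwa [closure_ball (0 : ℂ) one_ne_zero, mem_closedBall, dist_zero_right] at hmem
  refine le_antisymm hle (not_lt.1 fun hlt => hp ?_)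
  have hcball : c ∈ ball (0 : ℂ) 1 := by rwa [mem_ball, dist_zero_right]
  set F : ℂ → ℂ := Function.invFunOn ψ D with hF
  have hFdiff : DifferentiableOn ℂ F (ball 0 1) := by
    have h := Complex.differentiableOn_invFunOn_image hD hdiff hbij.injOn
      (fun z hz => Literature.Analysis.Complex.SCV.deriv_ne_zero_of_injOn hdiff hD hbij.injOn hz)
    rwa [hbij.image_eq] at h
  have hFc : Tendsto (fun t => F (ψ (γ t))) l (𝓝 (F c)) := by
    have h1 : Tendsto (fun t => ψ (γ t)) l (𝓝[ball 0 1] c) :=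
      tendsto_nhdsWithin_iff.2 ⟨hc, hball⟩
    exact ((hFdiff.continuousOn) c hcball).tendsto.comp h1
  have hFeq : (fun t => F (ψ (γ t))) =ᶠ[l] γ :=
    hγD.mono fun t ht => hbij.injOn.leftInvOn_invFunOn ht
  have hγ' : Tendsto γ l (𝓝 (F c)) := hFc.congr' hFeq
  rw [← tendsto_nhds_unique hγ' hγ]
  exact hbij.surjOn.mapsTo_invFunOn hcball

/-- **The boundary value `ψ(u)` of a dart `u = (v, [q,v])` of a grid domain lies on the unit
circle**: the hypothesis `Tendsto … (𝓝[<] 1) (𝓝 c)` of `hittingProbability_ratio_poissonKernel`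
forces `|c| = 1`, so that `poissonRatio (ψ w) c` is the Poisson kernel of `𝔻` at the boundary
point `c`, normalised at the centre. [cite: LawlerSchrammWerner2004, §2.2] -/
theorem norm_boundaryValue_eq_one {D : Set ℂ} (hD : IsGridDomain D) {ψ : ℂ → ℂ}
    (hψ : IsDiscMap D ψ) {q v : Site 2} (hq : q ∈ latticeVertices D) (hv : v ∉ latticeVertices D)
    (hqv : (zdGraph 2).Adj q v) {c : ℂ}
    (hc : Tendsto (fun t : ℝ => ψ (Site.toComplex q + t * (Site.toComplex v - Site.toComplex q)))
      (𝓝[<] (1 : ℝ)) (𝓝 c)) :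
    ‖c‖ = 1 :=
  norm_eq_one_of_tendsto hD.1 hψ (eventually_mem_nhdsLT hD hq hqv) hv (tendsto_edge_nhdsLT q v) hc

/-- With `|c| = 1` the continuous analog `λ` at the centre is `1`: `poissonRatio 0 c = 1`, matching
`H(0,u)/H(0,u) = 1`. [folklore] -/
theorem poissonRatio_zero {c : ℂ} (hc : ‖c‖ = 1) : poissonRatio 0 c = 1 := by
  simp [poissonRatio, hc]

/-- `λ ≥ 0` inside the closed disc. [folklore] -/
theorem poissonRatio_nonneg {z : ℂ} (hz : ‖z‖ ≤ 1) (c : ℂ) : 0 ≤ poissonRatio z c := by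
  unfold poissonRatio
  refine div_nonneg ?_ (sq_nonneg _)
  nlinarith [norm_nonneg z]

/-! ### The exit-probability ratio `h = H(·,u)/H(0,u)` -/

/-- If `H(0, u) ≠ 0` then `u = (v, [q,v])` is a genuine dart: `q ∼ v`, `q ∈ V(D)`, `v ∉ V(D)`
(otherwise `exitProb` is the junk value `0`). [folklore] -/
theorem dart_of_exitProb_ne_zero {D : Set ℂ} {a q v : Site 2} (h : exitProb D a q v ≠ 0) :
    (zdGraph 2).Adj q v ∧ q ∈ latticeVertices D ∧ v ∉ latticeVertices D := by
  by_contra hnot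
  exact h (exitProb_of_not hnot)

/-- For a genuine dart, `H(a, u) = G_D(a, q)/4`. [cite: KozdronLawler2005, §2.9] -/
theorem exitProb_eq {D : Set ℂ} {q v : Site 2}
    (hd : (zdGraph 2).Adj q v ∧ q ∈ latticeVertices D ∧ v ∉ latticeVertices D) (a : Site 2) :
    exitProb D a q v = SRW.killedGreen (ChordalLERW.siteGraph (latticeVertices D)) a q / 4 := by
  rw [exitProb, if_pos hd]

/-- If `H(0, u) ≠ 0` then `G_D(0, q) ≠ 0`. [folklore] -/
theorem killedGreen_ne_zero_of_exitProb_ne_zero {D : Set ℂ} {a q v : Site 2}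
    (h : exitProb D a q v ≠ 0) :
    SRW.killedGreen (ChordalLERW.siteGraph (latticeVertices D)) a q ≠ 0 := by
  rw [exitProb_eq (dart_of_exitProb_ne_zero h)] at h
  exact fun h0 => h (by rw [h0, zero_div])

/-- **The ratio `H(w,u)/H(0,u)` is the Green-function ratio `G_D(w,q)/G_D(0,q)`** (the factors
`1/4` of the last-exit decomposition cancel), as in the first line of the proof of Prop. 2.2.
[cite: LawlerSchrammWerner2004, §5.2] -/
theorem exitProb_ratio_eq {D : Set ℂ} {q v : Site 2} (h0 : exitProb D 0 q v ≠ 0) (w : Site 2) :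
    exitProb D w q v / exitProb D 0 q v =
      SRW.killedGreen (ChordalLERW.siteGraph (latticeVertices D)) w q /
        SRW.killedGreen (ChordalLERW.siteGraph (latticeVertices D)) 0 q := by
  have hd := dart_of_exitProb_ne_zero h0
  rw [exitProb_eq hd, exitProb_eq hd, div_div_div_cancel_right₀ (by norm_num : (4 : ℝ) ≠ 0)]

/-- **`H(0,u) ≠ 0` makes the killed Green function of `V(D)` with pole `q` converge at every
start** (`SRW.summable_killedTrans_of_killedGreen_ne_zero` for the walk on `V(D)`), which is what
the first-step (harmonicity) equation needs on an unbounded grid domain. [folklore] -/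
theorem summable_of_exitProb_ne_zero {D : Set ℂ} {q v : Site 2} (h0 : exitProb D 0 q v ≠ 0)
    (x : Site 2) :
    Summable fun n => SRW.killedTrans (ChordalLERW.siteGraph (latticeVertices D)) n x q :=
  SRW.summable_killedTrans_of_killedGreen_ne_zero (ChordalLERW.siteGraph_le_zdGraph _)
    (killedGreen_ne_zero_of_exitProb_ne_zero h0) x

/-- **`h = H(·,u)/H(0,u)` is harmonic off `q` for the walk on `V(D)` killed on leaving `V(D)`**
("We consider the discrete harmonic function `h(w) := H(w,u)/H(0,u)`", proof of Prop. 2.2).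
[cite: LawlerSchrammWerner2004, §5.2] -/
theorem isKilledHarmonicOn_exitProb_ratio {D : Set ℂ} {q v : Site 2} (h0 : exitProb D 0 q v ≠ 0) :
    IsKilledHarmonicOn (ChordalLERW.siteGraph (latticeVertices D))
      (fun w => exitProb D w q v / exitProb D 0 q v) {w | w ≠ q} := by
  have hsum := summable_of_exitProb_ne_zero h0
  have heq : (fun p => exitProb D p q v / exitProb D 0 q v) = fun p =>
      (SRW.killedGreen (ChordalLERW.siteGraph (latticeVertices D)) 0 q)⁻¹ *
        SRW.killedGreen (ChordalLERW.siteGraph (latticeVertices D)) p q := by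
    funext p
    rw [exitProb_ratio_eq h0, div_eq_inv_mul]
  rw [heq]
  exact (SRW.isKilledHarmonicOn_killedGreen hsum).const_mul _

/-- `h` is superharmonic for the killed walk everywhere (harmonic off `q`, a unit excess at the
pole divided by `G_D(0,q) > 0`). [folklore] -/
theorem isKilledSuperharmonicOn_exitProb_ratio {D : Set ℂ} {q v : Site 2}
    (h0 : exitProb D 0 q v ≠ 0) (S : Set (Site 2)) :
    IsKilledSuperharmonicOn (ChordalLERW.siteGraph (latticeVertices D))
      (fun w => exitProb D w q v / exitProb D 0 q v) S := by
  have hsum := summable_of_exitProb_ne_zero h0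
  have hG0 : 0 < SRW.killedGreen (ChordalLERW.siteGraph (latticeVertices D)) 0 q :=
    lt_of_le_of_ne (SRW.killedGreen_nonneg _ _ _) (killedGreen_ne_zero_of_exitProb_ne_zero h0).symm
  intro w _
  have hsup := SRW.isKilledSuperharmonicOn_killedGreen hsum univ w (mem_univ w)
  have heq : (fun p => exitProb D p q v / exitProb D 0 q v) = fun p =>
      (SRW.killedGreen (ChordalLERW.siteGraph (latticeVertices D)) 0 q)⁻¹ *
        SRW.killedGreen (ChordalLERW.siteGraph (latticeVertices D)) p q := by
    funext p
    rw [exitProb_ratio_eq h0, div_eq_inv_mul]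
  rw [heq, killedAvg_const_mul]
  exact mul_le_mul_of_nonneg_left hsup (inv_nonneg.2 hG0.le)

/-- `h(0) = 1`. [folklore] -/
theorem exitProb_ratio_zero {D : Set ℂ} {q v : Site 2} (h0 : exitProb D 0 q v ≠ 0) :
    exitProb D 0 q v / exitProb D 0 q v = 1 :=
  div_self h0

/-- `h ≥ 0`. [folklore] -/
theorem exitProb_ratio_nonneg (D : Set ℂ) (w q v : Site 2) :
    0 ≤ exitProb D w q v / exitProb D 0 q v :=
  div_nonneg (exitProb_nonneg D w q v) (exitProb_nonneg D 0 q v)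

/-- **`h` vanishes off `V(D)`** (boundary values `0`): a start `w ∉ V(D)`, `w ≠ q`, has no edge of
the walk on `V(D)`, so `H(w, u) = 0`. [folklore] -/
theorem exitProb_eq_zero_of_notMem {D : Set ℂ} {w q : Site 2} (hw : w ∉ latticeVertices D)
    (hwq : w ≠ q) (v : Site 2) : exitProb D w q v = 0 := by
  unfold exitProb
  split_ifs with hd
  · rw [SRW.killedGreen_eq_zero_of_forall_not_adj (fun y hy =>
      hw (ChordalLERW.siteGraph_adj_iff.1 hy).2.1) hwq, zero_div]
  · rfl

/-- `h` vanishes off `V(D)` (as a function on all of `ℤ²`; note `q ∈ V(D)` when `H(0,u) ≠ 0`).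
[folklore] -/
theorem exitProb_ratio_eq_zero_of_notMem {D : Set ℂ} {q v : Site 2} (h0 : exitProb D 0 q v ≠ 0)
    {w : Site 2} (hw : w ∉ latticeVertices D) : exitProb D w q v / exitProb D 0 q v = 0 := by
  rw [exitProb_eq_zero_of_notMem hw (fun h => hw (h ▸ (dart_of_exitProb_ne_zero h0).2.1)) v,
    zero_div]

/-- For the walk on a vertex set `A` (graph `siteGraph A`) and a function vanishing off `A`, the
killed neighbour average at a point of `A` is the plain four-neighbour average. [folklore] -/
theorem killedAvg_siteGraph_eq {A : Set (Site 2)} {h : Site 2 → ℝ} (hzero : ∀ w ∉ A, h w = 0)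
    {v : Site 2} (hv : v ∈ A) :
    killedAvg (ChordalLERW.siteGraph A) h v = 4⁻¹ * ∑ k : Fin 4, h (v + cornerUnit k) := by
  rw [killedAvg, ← sum_dir_eq_sum_cornerUnit (fun w => h (v + w))]
  congr 1
  refine Finset.sum_congr rfl fun e _ => ?_
  split_ifs with hadj
  · rfl
  · have hnot : v + SRW.stepVec e ∉ A := fun hmem =>
      hadj (ChordalLERW.siteGraph_adj_iff.2 ⟨SRW.adj_add_stepVec v e, hv, hmem⟩)
    exact (hzero _ hnot).symm

/-- **Killed-harmonic on `siteGraph A` = lattice-harmonic**, for functions vanishing off `A` and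
sites of `A` (the cemetery value `0` of the killed walk is the value of the zero extension).
[folklore] -/
theorem isKilledHarmonicOn_siteGraph_iff {A S : Set (Site 2)} {h : Site 2 → ℝ}
    (hzero : ∀ w ∉ A, h w = 0) (hS : S ⊆ A) :
    IsKilledHarmonicOn (ChordalLERW.siteGraph A) h S ↔ IsLatticeHarmonicOn h S := by
  refine forall₂_congr fun v hv => ?_
  rw [killedAvg_siteGraph_eq hzero (hS hv), latticeLaplacian_eq]
  constructor <;> intro H <;> linarith

/-- **`h = H(·,u)/H(0,u)` is lattice-harmonic on `V(D) ∖ {q}`** (the form consumed by the tree's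
conformal Harnack inequality `harnack_conformal` and interior gradient estimates), with `h ≥ 0` on
`ℤ²`, `h(0) = 1` and `h = 0` off `V(D)`. [cite: LawlerSchrammWerner2004, §5.2] -/
theorem isLatticeHarmonicOn_exitProb_ratio {D : Set ℂ} {q v : Site 2} (h0 : exitProb D 0 q v ≠ 0) :
    IsLatticeHarmonicOn (fun w => exitProb D w q v / exitProb D 0 q v)
      (latticeVertices D \ {q}) :=
  (isKilledHarmonicOn_siteGraph_iff (fun _ hw => exitProb_ratio_eq_zero_of_notMem h0 hw)
    sdiff_subset).1 ((isKilledHarmonicOn_exitProb_ratio h0).mono fun _ hw => hw.2)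

/-! ### The inverse disc map and the inner radius (interface to the conformal toolkit) -/

section Inverse

variable {D : Set ℂ} {ψ : ℂ → ℂ}

/-- `ψ` maps `D` into the disc. [folklore] -/
theorem IsDiscMap.norm_lt_one (hψ : IsDiscMap D ψ) {z : ℂ} (hz : z ∈ D) : ‖ψ z‖ < 1 := by
  have h := hψ.2.1.mapsTo hz
  rwa [mem_ball, dist_zero_right] at h

/-- `ψ⁻¹ ∘ ψ = id` on `D` (`ψ⁻¹ = Function.invFunOn ψ D`). [folklore] -/
theorem IsDiscMap.leftInvOn (hψ : IsDiscMap D ψ) : LeftInvOn (Function.invFunOn ψ D) ψ D :=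
  hψ.2.1.injOn.leftInvOn_invFunOn

/-- `ψ ∘ ψ⁻¹ = id` on the disc. [folklore] -/
theorem IsDiscMap.rightInvOn (hψ : IsDiscMap D ψ) :
    RightInvOn (Function.invFunOn ψ D) ψ (ball 0 1) :=
  hψ.2.1.surjOn.rightInvOn_invFunOn

/-- `ψ⁻¹` maps the disc into `D`. [folklore] -/
theorem IsDiscMap.mapsTo_inv (hψ : IsDiscMap D ψ) : MapsTo (Function.invFunOn ψ D) (ball 0 1) D :=
  hψ.2.1.surjOn.mapsTo_invFunOn

/-- `ψ⁻¹` is injective on the disc. [folklore] -/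
theorem IsDiscMap.injOn_inv (hψ : IsDiscMap D ψ) : InjOn (Function.invFunOn ψ D) (ball 0 1) :=
  hψ.rightInvOn.injOn

/-- **`ψ⁻¹(𝔻) = D`**: the inverse disc map is a conformal map of the disc ONTO `D` (the form
`F '' ball 0 1` in which `harnack_conformal` and `KoebeInterior.*` take the domain). [folklore] -/
theorem IsDiscMap.image_inv (hψ : IsDiscMap D ψ) : Function.invFunOn ψ D '' ball 0 1 = D := by
  refine Subset.antisymm (hψ.mapsTo_inv.image_subset) fun z hz => ?_
  exact ⟨ψ z, hψ.2.1.mapsTo hz, hψ.leftInvOn hz⟩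

/-- `ψ⁻¹ 0 = 0` (normalisation `ψ 0 = 0`, `0 ∈ D`). [folklore] -/
theorem IsDiscMap.inv_zero (hψ : IsDiscMap D ψ) (h0 : (0 : ℂ) ∈ D) : Function.invFunOn ψ D 0 = 0 := by
  have h := hψ.leftInvOn h0
  rwa [hψ.2.2.1] at h

/-- **`ψ⁻¹` is holomorphic on the disc** (inverse function theorem; the derivative of an
injective holomorphic map does not vanish, `SCV.deriv_ne_zero_of_injOn`). [folklore] -/
theorem IsDiscMap.differentiableOn_inv (hD : IsOpen D) (hψ : IsDiscMap D ψ) :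
    DifferentiableOn ℂ (Function.invFunOn ψ D) (ball 0 1) := by
  have h := Complex.differentiableOn_invFunOn_image hD hψ.1 hψ.2.1.injOn
    (fun z hz => Literature.Analysis.Complex.SCV.deriv_ne_zero_of_injOn hψ.1 hD hψ.2.1.injOn hz)
  rwa [hψ.2.1.image_eq] at h

/-- `ψ` is continuous on `D`. [folklore] -/
theorem IsDiscMap.continuousOn (hψ : IsDiscMap D ψ) : ContinuousOn ψ D := hψ.1.continuousOn

end Inverse

/-- The origin is a lattice point of every `D ∈ 𝔇`. [folklore] -/
theorem zero_mem_latticeVertices {D : Set ℂ} (hD : IsClassD D) : (0 : Site 2) ∈ latticeVertices D := by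
  have h : Site.toComplex (0 : Site 2) = 0 := Complex.ext (by simp) (by simp)
  show Site.toComplex 0 ∈ D
  rw [h]
  exact hD.2.2.1

/-- `inrad(D) > 0` for `D ∈ 𝔇` (`0 ∈ D`, `D` open). [folklore] -/
theorem inrad_pos {D : Set ℂ} (hD : IsClassD D) : 0 < infDist (0 : ℂ) Dᶜ := by
  have hne : (Dᶜ : Set ℂ).Nonempty := nonempty_compl.2 hD.2.2.2
  exact (hD.1.1.isClosed_compl.notMem_iff_infDist_pos hne).1 (fun h => h hD.2.2.1)

/-- **A nearest boundary obstruction**: for `D ∈ 𝔇` some point `b ∉ D` has `|b| = inrad(D)` (the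
infimum over the closed set `Dᶜ ≠ ∅` is attained); in particular `‖b - 0‖ ≤ 2 inrad(D)`, the
form consumed by `harnack_conformal` / `KoebeInterior.*`. [folklore] -/
theorem exists_notMem_norm_eq_inrad {D : Set ℂ} (hD : IsClassD D) :
    ∃ b : ℂ, b ∉ D ∧ ‖b‖ = infDist (0 : ℂ) Dᶜ := by
  have hne : (Dᶜ : Set ℂ).Nonempty := nonempty_compl.2 hD.2.2.2
  obtain ⟨b, hb, hdist⟩ := hD.1.1.isClosed_compl.exists_infDist_eq_dist hne (0 : ℂ)
  exact ⟨b, hb, by rw [hdist, dist_zero_left]⟩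

/-! ### Conformal Harnack and gradient bounds in the vocabulary of the statement -/

/-- At mesh `1` the nearest site to a lattice point is that point (`meshPoint_one` of
`LatticeDobrushinDomain.lean`, `nearestSite_meshPoint`). [folklore] -/
theorem nearestSite_one_toComplex (x : Site 2) : nearestSite 1 (Site.toComplex x) = x := by
  rw [← meshPoint_one]
  exact nearestSite_meshPoint one_ne_zero x

/-- The nearest site to the origin is the origin. [folklore] -/
theorem nearestSite_one_zero : nearestSite 1 (0 : ℂ) = 0 := by
  have h : Site.toComplex (0 : Site 2) = 0 := Complex.ext (by simp) (by simp)
  rw [← h]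
  exact nearestSite_one_toComplex 0

/-- **Harnack's inequality in conformal coordinates for `D ∈ 𝔇`** (Lawler–Schramm–Werner,
Lemma 5.2, `k = 0`, through the tree's `harnack_conformal` applied to `F = ψ⁻¹`): if `h ≥ 0` on
`ℤ²` is lattice-harmonic on `V(D)`, `r < 1`, `inrad(D) (1-r)² ≥ 10⁴` and `N ≥ 11000/(1-r)⁵`, then
every `x ∈ V(D)` with `|ψ(x)| ≤ r` satisfies `(c_*/2)^N h(0) ≤ h(x)` and `(c_*/2)^N h(x) ≤ h(0)`.
[cite: LawlerSchrammWerner2004, Lemma 5.2] -/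
theorem harnack_isDiscMap {D : Set ℂ} (hD : IsClassD D) {ψ : ℂ → ℂ} (hψ : IsDiscMap D ψ)
    {h : Site 2 → ℝ} (hpos : ∀ w, 0 ≤ h w) (hh : IsLatticeHarmonicOn h (latticeVertices D))
    {r : ℝ} (hr : r < 1) (hbig : 10000 ≤ infDist (0 : ℂ) Dᶜ * (1 - r) ^ 2)
    {N : ℕ} (hN : 11000 / (1 - r) ^ 5 ≤ N) {x : Site 2} (hx : x ∈ latticeVertices D)
    (hxr : ‖ψ (Site.toComplex x)‖ ≤ r) :
    (maneuverConst / 2) ^ N * h 0 ≤ h x ∧ (maneuverConst / 2) ^ N * h x ≤ h 0 := by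
  have hopen : IsOpen D := hD.1.1
  have hF0 : Function.invFunOn ψ D 0 = 0 := hψ.inv_zero hD.2.2.1
  have himg : Function.invFunOn ψ D '' ball 0 1 = D := hψ.image_inv
  obtain ⟨b, hbD, hbn⟩ := exists_notMem_norm_eq_inrad hD
  have hρ₀ := inrad_pos hD
  have hsub : ball (Function.invFunOn ψ D 0) (infDist (0 : ℂ) Dᶜ) ⊆
      Function.invFunOn ψ D '' ball 0 1 := by
    rw [hF0, himg]
    exact Metric.ball_infDist_compl_subset
  have hb : b ∉ Function.invFunOn ψ D '' ball 0 1 := by rwa [himg]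
  have hbρ : ‖b - Function.invFunOn ψ D 0‖ ≤ 2 * infDist (0 : ℂ) Dᶜ := by
    rw [hF0, sub_zero, hbn]
    linarith
  have hU : ∀ y : Site 2, meshPoint 1 y ∈ Function.invFunOn ψ D '' ball 0 1 →
      y ∈ latticeVertices D := fun y hy => by rwa [himg, meshPoint_one] at hy
  have key := harnack_conformal (hψ.differentiableOn_inv hopen) hψ.injOn_inv hρ₀ hsub hb hbρ hpos
    hh hU hr hbig hN hxr
  have hFx : Function.invFunOn ψ D (ψ (Site.toComplex x)) = Site.toComplex x := hψ.leftInvOn hx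
  rwa [hFx, hF0, nearestSite_one_toComplex, nearestSite_one_zero] at key

/-- **The discrete gradient estimate in conformal coordinates for `D ∈ 𝔇`, near a conformal
point** (Lawler–Schramm–Werner, Lemma 5.2, `k = 1`, through the tree's `lipschitz_conformal`):
with `h` as above, `r < 1`, `inrad(D)(1-r)² ≥ 4·10⁴`, `N ≥ 352000/(1-r)⁵`, for every site `x`
within distance `1` of a point `ψ⁻¹(ζ)`, `|ζ| ≤ r`:
`|h(x + e_k) - h(x)| ≤ 1024 C_top (2/c_*)^N h(0) / (inrad(D) (1-r)²)`. [cite: LawlerSchrammWerner2004, Lemma 5.2] -/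
theorem lipschitz_isDiscMap_near {D : Set ℂ} (hD : IsClassD D) {ψ : ℂ → ℂ} (hψ : IsDiscMap D ψ)
    {h : Site 2 → ℝ} (hpos : ∀ w, 0 ≤ h w) (hh : IsLatticeHarmonicOn h (latticeVertices D))
    {r : ℝ} (hr : r < 1) (hbig : 40000 ≤ infDist (0 : ℂ) Dᶜ * (1 - r) ^ 2)
    {N : ℕ} (hN : 352000 / (1 - r) ^ 5 ≤ N) {ζ : ℂ} (hζ : ‖ζ‖ ≤ r)
    {x : Site 2} (hx : ‖Site.toComplex x - Function.invFunOn ψ D ζ‖ ≤ 1) (k : Fin 4) :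
    |h (x + cornerUnit k) - h x| ≤
      1024 * topGradConst * (2 / maneuverConst) ^ N * h 0 / (infDist (0 : ℂ) Dᶜ * (1 - r) ^ 2) := by
  have hopen : IsOpen D := hD.1.1
  have hF0 : Function.invFunOn ψ D 0 = 0 := hψ.inv_zero hD.2.2.1
  have himg : Function.invFunOn ψ D '' ball 0 1 = D := hψ.image_inv
  obtain ⟨b, hbD, hbn⟩ := exists_notMem_norm_eq_inrad hD
  have hρ₀ := inrad_pos hD
  have hsub : ball (Function.invFunOn ψ D 0) (infDist (0 : ℂ) Dᶜ) ⊆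
      Function.invFunOn ψ D '' ball 0 1 := by
    rw [hF0, himg]
    exact Metric.ball_infDist_compl_subset
  have hb : b ∉ Function.invFunOn ψ D '' ball 0 1 := by rwa [himg]
  have hbρ : ‖b - Function.invFunOn ψ D 0‖ ≤ 2 * infDist (0 : ℂ) Dᶜ := by
    rw [hF0, sub_zero, hbn]
    linarith
  have hU : ∀ y : Site 2, meshPoint 1 y ∈ Function.invFunOn ψ D '' ball 0 1 →
      y ∈ latticeVertices D := fun y hy => by rwa [himg, meshPoint_one] at hy
  have hx' : ‖meshPoint 1 x - Function.invFunOn ψ D ζ‖ ≤ 1 := by rwa [meshPoint_one]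
  have key := lipschitz_conformal (hψ.differentiableOn_inv hopen) hψ.injOn_inv hρ₀ hsub hb hbρ
    hpos hh hU hr hbig hN hζ hx' k
  rwa [hF0, nearestSite_one_zero] at key

/-- **The discrete gradient estimate at a lattice point of `D ∈ 𝔇` in conformal position
`|ψ(x)| ≤ r`** (the previous lemma at `ζ = ψ(x)`). [cite: LawlerSchrammWerner2004, Lemma 5.2] -/
theorem lipschitz_isDiscMap {D : Set ℂ} (hD : IsClassD D) {ψ : ℂ → ℂ} (hψ : IsDiscMap D ψ)
    {h : Site 2 → ℝ} (hpos : ∀ w, 0 ≤ h w) (hh : IsLatticeHarmonicOn h (latticeVertices D))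
    {r : ℝ} (hr : r < 1) (hbig : 40000 ≤ infDist (0 : ℂ) Dᶜ * (1 - r) ^ 2)
    {N : ℕ} (hN : 352000 / (1 - r) ^ 5 ≤ N) {x : Site 2} (hx : x ∈ latticeVertices D)
    (hxr : ‖ψ (Site.toComplex x)‖ ≤ r) (k : Fin 4) :
    |h (x + cornerUnit k) - h x| ≤
      1024 * topGradConst * (2 / maneuverConst) ^ N * h 0 / (infDist (0 : ℂ) Dᶜ * (1 - r) ^ 2) := by
  refine lipschitz_isDiscMap_near hD hψ hpos hh hr hbig hN hxr ?_ k
  rw [hψ.leftInvOn hx, sub_self, norm_zero]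
  exact zero_le_one

end LSWGrid

end Literature.Probability.LatticeModels

end
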